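import Mathlib

/-!
# Route BarrierLever — item `DescentCertificatesFail` (stmt-ValiantsHypothesis-19579): PROVED
# (the pure descent / "common points drop out" certificate scheme for UT-D is refuted)

Closing file (`--workitem stmt-ValiantsHypothesis-19579`; cell valiant-natproofs, rung V4, 𝒟-side;
prover seat valiant-natproofs-prover gen 6; statement and proof idea by planner p1-g9, memo
`HOME/p1/UTD-memo-g9.md` §3(o)). Definition-free.

The item is the NEGATION of `DescentCertificatesExist` (stmt-19627): «for every injective layout
`(u, w)` there are a coordinate order `ord`, a valuation `e` on literal pairs and an assignment `π₀`
(fixing the common points) whose descent cost — the sum over unmatched columns `j` of the least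
`e`-value of an admissible (top, bottom) label pair of the row `u (π₀ j)` against `w j` — is STRICTLY
smaller than that of every other admissible assignment».

**Counterexample (the antipodal star, `h = 5`, `r = 6`).** Rows `U = {∅, {0}, {1}, {2}, {3}, {4}}`,
columns `W = {univ ∖ {k} : k < 5} ∪ {univ}`; no row is a column. Fix `ord, e, π₀` and let
`x = ord⁻¹(2)` be the coordinate at the interior position `2`. For every column `W_j` (which misses at
most one coordinate) the admissible label pairs and their `e`-values for the rows `∅` and `{x}`
COINCIDE (`term_set_eq`): the mismatch positions of the two rows differ only at position `2`, both
contain a position `≤ 1` and a position `≥ 3`, so upper bounds `a` / lower bounds `c` of the mismatch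
set are the same for both rows (and `a ≥ 3`, whence the row literal at `a` is `natAdd a` for both),
and the singleton alternative never applies. Hence the assignment `σ = π₀ ∘ (j₁ j₂)` swapping the
columns of these two rows has the SAME cost as `π₀`, contradicting strictness
(`descentCertificatesFail`, the item's signature verbatim).

WHAT THIS IS NOT: UT-D itself (stmt-19316 `TropicalDetCertificatesExist`) is not touched — the star
layout has tropical-determinant certificates (planner census); only the label-min descent SCHEME is
refuted. Nothing on TT / TNS / 19717, crux 14610, or VP vs VNP.
-/

-- layout Summits/ValiantsHypothesis/ValiantsHypothesis forces the duplicated namespace component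
set_option linter.dupNamespace false

namespace Summit.ValiantsHypothesis.ValiantsHypothesis.Theorems.BarrierLever.DescentFail

open Finset

/-- **Key lemma.** Against a column `W ⊆ Fin 5` missing at most one coordinate, the rows `∅` and
`{ord⁻¹ 2}` have the same set of `e`-values of admissible label pairs. -/
theorem term_set_eq (ord : Equiv.Perm (Fin 5)) (e : Fin (5 + 5) → Fin (5 + 5) → ℕ)
    (W : Finset (Fin 5)) (hW : ∀ y z : Fin 5, y ≠ z → y ∈ W ∨ z ∈ W) :
    {n : ℕ | ∃ a c : Fin 5, ((c < a ∧ (∀ m : Fin 5, (ord.symm m ∈ (∅ : Finset (Fin 5)) ↔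
        ord.symm m ∉ W) → m ≤ a) ∧ (∀ m : Fin 5, (ord.symm m ∈ (∅ : Finset (Fin 5)) ↔
        ord.symm m ∉ W) → c ≤ m)) ∨ (a = c ∧ ∀ m : Fin 5, (ord.symm m ∈ (∅ : Finset (Fin 5)) ↔
        ord.symm m ∉ W) ↔ m = a)) ∧ n = e (if ord.symm a ∈ (∅ : Finset (Fin 5)) then
        Fin.castAdd 5 a else Fin.natAdd 5 a) (if ord.symm c ∈ W then Fin.natAdd 5 c else
        Fin.castAdd 5 c)} =
    {n : ℕ | ∃ a c : Fin 5, ((c < a ∧ (∀ m : Fin 5, (ord.symm m ∈ ({ord.symm 2} : Finset (Fin 5)) ↔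
        ord.symm m ∉ W) → m ≤ a) ∧ (∀ m : Fin 5, (ord.symm m ∈ ({ord.symm 2} : Finset (Fin 5)) ↔
        ord.symm m ∉ W) → c ≤ m)) ∨ (a = c ∧ ∀ m : Fin 5, (ord.symm m ∈
        ({ord.symm 2} : Finset (Fin 5)) ↔ ord.symm m ∉ W) ↔ m = a)) ∧ n = e (if ord.symm a ∈
        ({ord.symm 2} : Finset (Fin 5)) then Fin.castAdd 5 a else Fin.natAdd 5 a)
        (if ord.symm c ∈ W then Fin.natAdd 5 c else Fin.castAdd 5 c)} := by
  -- the two mismatch predicates, simplified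
  have hΔ0 : ∀ m : Fin 5, (ord.symm m ∈ (∅ : Finset (Fin 5)) ↔ ord.symm m ∉ W) ↔ ord.symm m ∈ W := by
    intro m
    simp only [Finset.notMem_empty, false_iff, not_not]
  have hmem2 : ∀ m : Fin 5, ord.symm m ∈ ({ord.symm 2} : Finset (Fin 5)) ↔ m = 2 := by
    intro m
    rw [Finset.mem_singleton, ord.symm.injective.eq_iff]
  have hΔ1 : ∀ m : Fin 5, m ≠ 2 →
      ((ord.symm m ∈ ({ord.symm 2} : Finset (Fin 5)) ↔ ord.symm m ∉ W) ↔ ord.symm m ∈ W) := by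
    intro m hm
    rw [hmem2]
    simp only [hm, false_iff, not_not]
  -- a low and a high mismatch position common to both rows
  obtain ⟨mL, hmL, hmLW⟩ : ∃ m : Fin 5, m ≤ 1 ∧ ord.symm m ∈ W := by
    rcases hW (ord.symm 0) (ord.symm 1) (by rw [Ne, ord.symm.injective.eq_iff]; decide) with h0 | h1
    · exact ⟨0, by decide, h0⟩
    · exact ⟨1, le_rfl, h1⟩
  obtain ⟨mH, hmH, hmHW⟩ : ∃ m : Fin 5, 3 ≤ m ∧ ord.symm m ∈ W := by
    rcases hW (ord.symm 3) (ord.symm 4) (by rw [Ne, ord.symm.injective.eq_iff]; decide) with h3 | h4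
    · exact ⟨3, le_rfl, h3⟩
    · exact ⟨4, by decide, h4⟩
  have hmL2 : mL ≠ 2 := fun hh => absurd hmL (by rw [hh]; decide)
  have hmH2 : mH ≠ 2 := fun hh => absurd hmH (by rw [hh]; decide)
  have hmLH : mL ≠ mH := fun hh => absurd (hmH.trans (hh ▸ hmL : mH ≤ 1)) (by decide)
  -- upper bounds agree
  have hUB : ∀ a : Fin 5,
      (∀ m : Fin 5, (ord.symm m ∈ (∅ : Finset (Fin 5)) ↔ ord.symm m ∉ W) → m ≤ a) ↔
      (∀ m : Fin 5, (ord.symm m ∈ ({ord.symm 2} : Finset (Fin 5)) ↔ ord.symm m ∉ W) → m ≤ a) := by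
    intro a
    by_cases ha : (2 : Fin 5) ≤ a
    · refine forall_congr' fun m => ?_
      by_cases hm : m = 2
      · subst hm
        exact ⟨fun _ _ => ha, fun _ _ => ha⟩
      · rw [hΔ0 m, hΔ1 m hm]
    · constructor
      · intro hh
        exact absurd (le_trans (by decide) ((hmH.trans (hh mH ((hΔ0 mH).mpr hmHW))))) ha
      · intro hh
        exact absurd (le_trans (by decide) ((hmH.trans (hh mH ((hΔ1 mH hmH2).mpr hmHW))))) ha
  -- lower bounds agree
  have hLB : ∀ c : Fin 5,
      (∀ m : Fin 5, (ord.symm m ∈ (∅ : Finset (Fin 5)) ↔ ord.symm m ∉ W) → c ≤ m) ↔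
      (∀ m : Fin 5, (ord.symm m ∈ ({ord.symm 2} : Finset (Fin 5)) ↔ ord.symm m ∉ W) → c ≤ m) := by
    intro c
    by_cases hc : c ≤ (2 : Fin 5)
    · refine forall_congr' fun m => ?_
      by_cases hm : m = 2
      · subst hm
        exact ⟨fun _ _ => hc, fun _ _ => hc⟩
      · rw [hΔ0 m, hΔ1 m hm]
    · constructor
      · intro hh
        exact absurd (le_trans ((hh mL ((hΔ0 mL).mpr hmLW)).trans hmL) (by decide)) hc
      · intro hh
        exact absurd (le_trans ((hh mL ((hΔ1 mL hmL2).mpr hmLW)).trans hmL) (by decide)) hc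
  -- the singleton alternative never applies
  have hS0 : ∀ a : Fin 5,
      ¬ ∀ m : Fin 5, (ord.symm m ∈ (∅ : Finset (Fin 5)) ↔ ord.symm m ∉ W) ↔ m = a := by
    intro a hh
    have h1 : mL = a := (hh mL).mp ((hΔ0 mL).mpr hmLW)
    have h2 : mH = a := (hh mH).mp ((hΔ0 mH).mpr hmHW)
    exact hmLH (h1.trans h2.symm)
  have hS1 : ∀ a : Fin 5,
      ¬ ∀ m : Fin 5, (ord.symm m ∈ ({ord.symm 2} : Finset (Fin 5)) ↔ ord.symm m ∉ W) ↔ m = a := by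
    intro a hh
    have h1 : mL = a := (hh mL).mp ((hΔ1 mL hmL2).mpr hmLW)
    have h2 : mH = a := (hh mH).mp ((hΔ1 mH hmH2).mpr hmHW)
    exact hmLH (h1.trans h2.symm)
  -- an upper bound `a` is `≥ 3`, so the row literal at `a` is `natAdd a` for both rows
  have hlit : ∀ a : Fin 5,
      (∀ m : Fin 5, (ord.symm m ∈ (∅ : Finset (Fin 5)) ↔ ord.symm m ∉ W) → m ≤ a) →
      (if ord.symm a ∈ (∅ : Finset (Fin 5)) then Fin.castAdd 5 a else Fin.natAdd 5 a) =
      (if ord.symm a ∈ ({ord.symm 2} : Finset (Fin 5)) then Fin.castAdd 5 a else Fin.natAdd 5 a) := by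
    intro a hub
    have ha3 : 3 ≤ a := hmH.trans (hub mH ((hΔ0 mH).mpr hmHW))
    have ha2 : a ≠ 2 := fun hh => absurd ha3 (by rw [hh]; decide)
    rw [if_neg (Finset.notMem_empty _), if_neg (fun hh => ha2 ((hmem2 a).mp hh))]
  ext n
  simp only [Set.mem_setOf_eq]
  constructor
  · rintro ⟨a, c, hcond, hn⟩
    rcases hcond with ⟨hca, hub, hlb⟩ | ⟨-, hsing⟩
    · exact ⟨a, c, Or.inl ⟨hca, (hUB a).mp hub, (hLB c).mp hlb⟩, by rw [hn, hlit a hub]⟩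
    · exact absurd hsing (hS0 a)
  · rintro ⟨a, c, hcond, hn⟩
    rcases hcond with ⟨hca, hub, hlb⟩ | ⟨-, hsing⟩
    · have hub' := (hUB a).mpr hub
      exact ⟨a, c, Or.inl ⟨hca, hub', (hLB c).mpr hlb⟩, by rw [hn, hlit a hub']⟩
    · exact absurd hsing (hS1 a)

/-- **Item stmt-ValiantsHypothesis-19579 `DescentCertificatesFail`** (signature verbatim): the pure
descent certificate scheme fails on the antipodal star layout at `h = 5`. -/
theorem descentCertificatesFail :
    ¬ (∀ (h r : ℕ) (u w : Fin r → Finset (Fin h)), Function.Injective u → Function.Injective w → ∃ (ord : Equiv.Perm (Fin h)) (e : Fin (h + h) → Fin (h + h) → ℕ) (π₀ : Equiv.Perm (Fin r)), (∀ j, (∃ i, u i = w j) → u (π₀ j) = w j) ∧ ∀ σ : Equiv.Perm (Fin r), (∀ j, (∃ i, u i = w j) → u (σ j) = w j) → σ ≠ π₀ → (∑ j ∈ Finset.univ.filter (fun j => ∀ i, u i ≠ w j), sInf {n : ℕ | ∃ a c : Fin h, ((c < a ∧ (∀ m : Fin h, (ord.symm m ∈ u (π₀ j) ↔ ord.symm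 m ∉ w j) → m ≤ a) ∧ (∀ m : Fin h, (ord.symm m ∈ u (π₀ j) ↔ ord.symm m ∉ w j) → c ≤ m)) ∨ (a = c ∧ ∀ m : Fin h, (ord.symm m ∈ u (π₀ j) ↔ ord.symm m ∉ w j) ↔ m = a)) ∧ n = e (if ord.symm a ∈ u (π₀ j) then Fin.castAdd h a else Fin.natAdd h a) (if ord.symm c ∈ w j then Fin.natAdd h c else Fin.castAdd h c)}) < (∑ j ∈ Finset.univ.filter (fun j => ∀ i, u i ≠ w j), sInf {n : ℕ | ∃ a c : Fin h, ((c < a ∧ (∀ m : Fin h, (ord.symm m ∈ u (σ j) ↔ ord.symm m ∉ w j) → m ≤ a) ∧ (∀ m : Fin h, (ord.symm m ∈ u (σ j) ↔ ord.symm m ∉ w j) → c ≤ m)) ∨ (a = c ∧ ∀ m : Fin h, (ord.symm m ∈ u (σ j) ↔ ord.symm m ∉ w j) ↔ m = a)) ∧ n = e (if ord.symm a ∈ u (σ j) then Fin.castAdd h a else Fin.natAdd h a) (if ord.symm c ∈ w j then Fin.natAdd h c else Fin.castAdd h c)})) := by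
  intro H
  -- the antipodal star at h = 5
  have hU : Function.Injective
      (![∅, {0}, {1}, {2}, {3}, {4}] : Fin 6 → Finset (Fin 5)) := by decide
  have hWi : Function.Injective
      (![univ.erase 0, univ.erase 1, univ.erase 2, univ.erase 3, univ.erase 4, univ] :
        Fin 6 → Finset (Fin 5)) := by decide
  have hnomatch : ∀ j i : Fin 6, (![∅, {0}, {1}, {2}, {3}, {4}] : Fin 6 → Finset (Fin 5)) i ≠
      (![univ.erase 0, univ.erase 1, univ.erase 2, univ.erase 3, univ.erase 4, univ] :
        Fin 6 → Finset (Fin 5)) j := by decide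
  have hcover : ∀ (j : Fin 6) (y z : Fin 5), y ≠ z →
      y ∈ (![univ.erase 0, univ.erase 1, univ.erase 2, univ.erase 3, univ.erase 4, univ] :
        Fin 6 → Finset (Fin 5)) j ∨
      z ∈ (![univ.erase 0, univ.erase 1, univ.erase 2, univ.erase 3, univ.erase 4, univ] :
        Fin 6 → Finset (Fin 5)) j := by decide
  have hzero : (![∅, {0}, {1}, {2}, {3}, {4}] : Fin 6 → Finset (Fin 5)) 0 = ∅ := rfl
  have hsucc : ∀ y : Fin 5, (![∅, {0}, {1}, {2}, {3}, {4}] : Fin 6 → Finset (Fin 5)) y.succ = {y} := by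
    decide
  obtain ⟨ord, e, π₀, -, hstrict⟩ := H 5 6 _ _ hU hWi
  set u : Fin 6 → Finset (Fin 5) := ![∅, {0}, {1}, {2}, {3}, {4}] with hu_def
  set w : Fin 6 → Finset (Fin 5) :=
    ![univ.erase 0, univ.erase 1, univ.erase 2, univ.erase 3, univ.erase 4, univ] with hw_def
  -- the two indistinguishable rows `∅ = u 0` and `{x} = u x.succ`, `x = ord⁻¹ 2`
  set x : Fin 5 := ord.symm 2 with hx
  set j₁ : Fin 6 := π₀.symm 0 with hj₁
  set j₂ : Fin 6 := π₀.symm x.succ with hj₂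
  have hπ1 : π₀ j₁ = 0 := π₀.apply_symm_apply 0
  have hπ2 : π₀ j₂ = x.succ := π₀.apply_symm_apply _
  have hj12 : j₁ ≠ j₂ := by
    intro hh
    have := hπ1.symm.trans ((congrArg π₀ hh).trans hπ2)
    exact (Fin.succ_ne_zero x) this.symm
  set σ : Equiv.Perm (Fin 6) := π₀ * Equiv.swap j₁ j₂ with hσ
  have hσ1 : σ j₁ = x.succ := by
    rw [hσ, Equiv.Perm.mul_apply, Equiv.swap_apply_left, hπ2]
  have hσ2 : σ j₂ = 0 := by
    rw [hσ, Equiv.Perm.mul_apply, Equiv.swap_apply_right, hπ1]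
  have hσ3 : ∀ j, j ≠ j₁ → j ≠ j₂ → σ j = π₀ j := fun j h1 h2 => by
    rw [hσ, Equiv.Perm.mul_apply, Equiv.swap_apply_of_ne_of_ne h1 h2]
  have hne : σ ≠ π₀ := by
    intro hh
    have h1 : σ j₁ = π₀ j₁ := by rw [hh]
    rw [hσ1, hπ1] at h1
    exact Fin.succ_ne_zero x h1
  have hlt := hstrict σ (fun j hj => by obtain ⟨i, hi⟩ := hj; exact absurd hi (hnomatch j i)) hne
  have hfilter : Finset.univ.filter (fun j => ∀ i, u i ≠ w j) = Finset.univ :=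
    Finset.filter_true_of_mem fun j _ i => hnomatch j i
  rw [hfilter] at hlt
  refine absurd hlt (not_lt.mpr (le_of_eq ?_))
  refine Finset.sum_congr rfl fun j _ => ?_
  by_cases h1 : j = j₁
  · rw [h1, hσ1, hπ1, hsucc, hzero]
    exact congrArg sInf (term_set_eq ord e (w j₁) (hcover j₁)).symm
  · by_cases h2 : j = j₂
    · rw [h2, hσ2, hπ2, hsucc, hzero]
      exact congrArg sInf (term_set_eq ord e (w j₂) (hcover j₂))
    · rw [hσ3 j h1 h2]

end Summit.ValiantsHypothesis.ValiantsHypothesis.Theorems.BarrierLever.DescentFail
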